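/-
Origin: expansion seat `prover-pub-hodgecm-mc-carch-1-g4-0`, handover #CA32 2026-08-20T08:00Z md5 441eb2b3213d (199 l., 13 decls; NEW additive leaf; imports installed #CA27 Model.ArchKTypeOfDefiniteChar + sinst #1208 Model.ArchLineSlotTypeCont + RUN-44 #CA31 Model.ArchUnitaryFormDetChar; RUN 45; cert certs/ax-ArchKTypeOfLambdaDef-441eb2b3213d.log: rc 0 / 26 s / 0 warnings / 13/13 trio) (`HOME/mc/pub-hodgecm-mc-carch-1/pkg45/HodgeCM/Model/ArchKTypeOfLambdaDef.lean`, md5 441eb2b3213d, 199 lines);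
landed by the gen-17 packager (p-g17) in gate run 45 as `HodgeCM/Model/ArchKTypeOfLambdaDef.lean` (verbatim).
-/
/-
Copyright (c) 2026. Released under Apache 2.0 license as described in the file LICENSE.
Cell pub-hodgecm, MODEL layer (construction prover mc-carch-1, gen 4), BINDER-OWNERS row 12 `C`, junction (C-Λ), item (Λ-def):
the see-saw factor of the line-0 scalar at a DEFINITE place is `det^{ℓ_b}`.
-/
import Summits.HodgeConjecture.HodgeCM.Model.ArchKTypeOfDefiniteChar
import Summits.HodgeConjecture.HodgeCM.Model.ArchUnitaryFormDetChar
import Summits.HodgeConjecture.HodgeCM.Model.ArchLineSlotTypeCont_2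

/-!
# (C-Λ), item (Λ-def): the see-saw discrepancy of line 0 is a power of `det` on `U(V)(L_b)`, `b` definite

#CA27's line-0 scalar on archimedean elements is `archScalar_zeroG … η₀ = (η₀-part) · (cmLineChar₀-part)`; on the one-place elements
`archSingle (w b) u`, `u ∈ U(σ_{w(b)} diag frameD V)(ℂ)` (a COMPACT `U(3)` for `b ≠ v₁`: `frameD_sign_of_ne`), the `cmLineChar₀`-part is the character
`defLambdaChar V S hGR hGR₀ hGR₁ b` of this file.

* § 1 `defLambdaChar b`, `archScalar_zeroG_archSingle` (the split), `continuous_defLambdaChar (h₁W)` — from SIGN FACTS ONLY (sinst #1208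
  `continuous_cmLineChar₀_of_signs`, K-1 `continuous_archToAdelic`, `continuous_archSingle`);
* § 2 `archLocal_eq_form` — the local group IS `unitaryGroupOfForm conj (diagonal (σ_{w(b)} ∘ frameD V))` (`Matrix.diagonal_map`), its entries real
  (`frameD_real` + `IsCMField.complexEmbedding_complexConj`) of one sign off `v₁` (`frameD_sign_of_ne`, `mk_cmPlaceOver_ne`);
* § 3 **`exists_defLambdaExponent (h₁W) (hb : b ≠ v₁) : ∃ ℓ : ℤ, ∀ u, defLambdaChar b u = det(u)^ℓ`** (#CA31 `U3FormChar.exists_zpow_of_continuous_form`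
  through `MulEquiv.subgroupCongr`), the exponent OF RECORD `defLambdaExponent … b hb : ℤ` and `defLambdaChar_eq_zpow`;
* § 4 the (c5)₀ SOCKET **`hdef_zero_of_archType`**: if the η₀-part is `det(u)^{m b}` on every `U(V)(L_b)` (`b ≠ v₁`) and
  `m b + defLambdaExponent b + a b = 0`, then the `hdef` hypothesis of #CA27 `harch_zero_of_defTypeG` (hence the `harch₀` input of the row-12 term) HOLDS —
  (c5)₀ is a READ-OFF condition on the type of η₀ at the definite places (at the R1 pin: of `χV · ν₁⁻¹`), no longer on an opaque character.

0 records, 0 `def … : Prop`, nothing cited as a hypothesis.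
-/

set_option autoImplicit false

noncomputable section

open NumberField NumberField.InfinitePlace NumberField.mixedEmbedding IsDedekindDomain
open scoped Matrix Classical
open ComplexConjugate
open Literature.NumberTheory.Automorphic Literature.NumberTheory.Automorphic.UnitaryGroup Literature.NumberTheory.Weil1964
open Literature.NumberTheory.GelbartRogawski1991 Literature.NumberTheory.GelbartRogawski1991.UnitaryDualPair
open HodgeCM.Adelic HodgeCM.PerL34 HodgeCM.Model.HypCensus HodgeCM.Model.ArchSideTerm

namespace HodgeCM.Model

section LambdaDef

variable {L : CMField} {ι₁ : L →+* ℂ} (V : HermSpace3 L ι₁) (S : StubTree.SeesawDatum L)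
variable
  (hGR : (cmSplittingDatum (L : Type) finProdFinEquiv (frameD V) (frameD_real V) (frameD_ne V) (dW S) (dW_real S) (dW_ne S)).CompatibleSplitting)
  (hGR₀ : (cmSplittingDatum (L : Type) (e₁) (frameD V) (frameD_real V) (frameD_ne V) (lineVec (L : Type) (dW S 0))
    (fun _ => dW_real S 0) (fun _ => dW_ne S 0)).CompatibleSplitting)
  (hGR₁ : (cmSplittingDatum (L : Type) (e₁) (frameD V) (frameD_real V) (frameD_ne V) (lineVec (L : Type) (dW S 1))
    (fun _ => dW_real S 1) (fun _ => dW_ne S 1)).CompatibleSplitting)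
  (η₀ : CMAdelic (L : Type) (frameD V) × CMAdelicOne (L : Type) →* ℂˣ)

/-! ## § 1 The see-saw factor at a place -/

/-- **`λ_b : U(V)(L_b) →* ℂˣ`, `u ↦ χ₀((archSingle (w b) u)^𝔸, 1)`** — the `cmLineChar₀`-part of #CA27's `archScalar_zeroG` on one-place elements. -/
def defLambdaChar (b : {v : InfinitePlace ↥(maximalRealSubfield L) // v.IsReal}) :
    ↥(UnitaryGroup.archLocal (L : Type) 3 (Matrix.diagonal (frameD V)) (cmPlaceOver (L : Type) b)) →* ℂˣ :=
  (cmLineChar₀ (L : Type) finProdFinEquiv e₁ (frameD V) (frameD_real V) (frameD_ne V) (dW S) (dW_real S) (dW_ne S) hGR hGR₀ hGR₁).comp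
    (MonoidHom.prod ((UnitaryGroup.archToAdelic (↥(maximalRealSubfield L)) L (IsCMField.complexConj L) 3 (Matrix.diagonal (frameD V))).comp
      (UnitaryGroup.archSingle (↥(maximalRealSubfield L)) L (IsCMField.complexConj L) 3 (Matrix.diagonal (frameD V))
        (IsCMField.complexConj_ne_one L) (NumberField.complexConj_smul_infinitePlace (L : Type)) (cmPlaceOver (L : Type) b))) 1)

/-- (Ported verbatim from the HodgeCMPerL package; no docstring in the source.) -/
theorem defLambdaChar_apply (b : {v : InfinitePlace ↥(maximalRealSubfield L) // v.IsReal})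
    (u : UnitaryGroup.archLocal (L : Type) 3 (Matrix.diagonal (frameD V)) (cmPlaceOver (L : Type) b)) :
    defLambdaChar V S hGR hGR₀ hGR₁ b u =
      cmLineChar₀ (L : Type) finProdFinEquiv e₁ (frameD V) (frameD_real V) (frameD_ne V) (dW S) (dW_real S) (dW_ne S) hGR hGR₀ hGR₁
        (UnitaryGroup.archToAdelic (↥(maximalRealSubfield L)) L (IsCMField.complexConj L) 3 (Matrix.diagonal (frameD V))
          (UnitaryGroup.archSingle (↥(maximalRealSubfield L)) L (IsCMField.complexConj L) 3 (Matrix.diagonal (frameD V))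
            (IsCMField.complexConj_ne_one L) (NumberField.complexConj_smul_infinitePlace (L : Type)) (cmPlaceOver (L : Type) b) u), 1) :=
  rfl

/-- the SPLIT of #CA27's line-0 scalar on one-place elements: `(η₀-part) · λ_b` (definitional). -/
theorem archScalar_zeroG_archSingle (b : {v : InfinitePlace ↥(maximalRealSubfield L) // v.IsReal})
    (u : UnitaryGroup.archLocal (L : Type) 3 (Matrix.diagonal (frameD V)) (cmPlaceOver (L : Type) b)) :
    archScalar_zeroG V S hGR hGR₀ hGR₁ η₀
        (UnitaryGroup.archSingle (↥(maximalRealSubfield L)) L (IsCMField.complexConj L) 3 (Matrix.diagonal (frameD V))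
          (IsCMField.complexConj_ne_one L) (NumberField.complexConj_smul_infinitePlace (L : Type)) (cmPlaceOver (L : Type) b) u) =
      η₀ (UnitaryGroup.archToAdelic (↥(maximalRealSubfield L)) L (IsCMField.complexConj L) 3 (Matrix.diagonal (frameD V))
          (UnitaryGroup.archSingle (↥(maximalRealSubfield L)) L (IsCMField.complexConj L) 3 (Matrix.diagonal (frameD V))
            (IsCMField.complexConj_ne_one L) (NumberField.complexConj_smul_infinitePlace (L : Type)) (cmPlaceOver (L : Type) b) u), 1) *
        defLambdaChar V S hGR hGR₀ hGR₁ b u :=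
  rfl

variable (h₁W : (∀ j, 0 < (ι₁ (dW S j)).re) ∨ ∀ j, (ι₁ (dW S j)).re < 0)

include h₁W in
/-- `u ↦ (λ_b u : ℂ)` is continuous on the local group. -/
theorem continuous_defLambdaChar (b : {v : InfinitePlace ↥(maximalRealSubfield L) // v.IsReal}) :
    Continuous fun u : UnitaryGroup.archLocal (L : Type) 3 (Matrix.diagonal (frameD V)) (cmPlaceOver (L : Type) b) =>
      ((defLambdaChar V S hGR hGR₀ hGR₁ b u : ℂˣ) : ℂ) :=
  (continuous_cmLineChar₀_of_signs (L : Type) finProdFinEquiv e₁ (frameD V) (frameD_real V) (frameD_ne V) (dW S) (dW_real S) (dW_ne S)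
    hGR hGR₀ hGR₁ ι₁ (frameD_sign_ι₁' V) h₁W (frameD_sign_of_ne V)).comp
    (((UnitaryGroup.continuous_archToAdelic (↥(maximalRealSubfield L)) L (IsCMField.complexConj L) 3 (Matrix.diagonal (frameD V))).comp
      (UnitaryGroup.continuous_archSingle (↥(maximalRealSubfield L)) L (IsCMField.complexConj L) 3 (Matrix.diagonal (frameD V))
        (IsCMField.complexConj_ne_one L) (NumberField.complexConj_smul_infinitePlace (L : Type)) (cmPlaceOver (L : Type) b))).prodMk
      continuous_const)

/-! ## § 2 The local group is `U(H)` for the real diagonal `H = σ_{w(b)}(diag frameD V)` -/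

/-- the entries of `H`. -/
def placeEntries (b : {v : InfinitePlace ↥(maximalRealSubfield L) // v.IsReal}) : Fin 3 → ℂ :=
  fun i => (cmPlaceOver (L : Type) b).1.embedding (frameD V i)

/-- (Ported verbatim from the HodgeCMPerL package; no docstring in the source.) -/
theorem archLocal_eq_form (b : {v : InfinitePlace ↥(maximalRealSubfield L) // v.IsReal}) :
    UnitaryGroup.archLocal (L : Type) 3 (Matrix.diagonal (frameD V)) (cmPlaceOver (L : Type) b) =
      unitaryGroupOfForm (starRingEnd ℂ) (Matrix.diagonal (placeEntries V b)) := by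
  rw [UnitaryGroup.archLocal, Matrix.diagonal_map (map_zero _)]
  rfl

/-- the entries are real … -/
theorem placeEntries_real (b : {v : InfinitePlace ↥(maximalRealSubfield L) // v.IsReal}) (i : Fin 3) :
    (((placeEntries V b i).re : ℝ) : ℂ) = placeEntries V b i := by
  rw [← Complex.conj_eq_iff_re, placeEntries, ← IsCMField.complexEmbedding_complexConj, frameD_real V i]

/-- the chosen complex place over `b ≠ v₁` is not the place of `ι₁`. -/
theorem mk_cmPlaceOver_ne {b : {v : InfinitePlace ↥(maximalRealSubfield L) // v.IsReal}} (hb : b ≠ HypCensus.cmPlace (L : Type) ι₁) :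
    InfinitePlace.mk (cmPlaceOver (L : Type) b).1.embedding ≠ InfinitePlace.mk ι₁ := by
  rw [InfinitePlace.mk_embedding]
  intro h
  apply hb
  apply Subtype.ext
  have hc := cmPlaceOver_comap (L : Type) b
  rw [h] at hc
  exact hc.symm

/-- … and of one sign off `v₁`. -/
theorem placeEntries_sign {b : {v : InfinitePlace ↥(maximalRealSubfield L) // v.IsReal}} (hb : b ≠ HypCensus.cmPlace (L : Type) ι₁) :
    (∀ i, 0 < (placeEntries V b i).re) ∨ ∀ i, (placeEntries V b i).re < 0 :=
  frameD_sign_of_ne V _ (mk_cmPlaceOver_ne hb)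

/-! ## § 3 The exponent `ℓ_b` of record -/

include h₁W in
/-- **(Λ-def)**: at a definite place the see-saw factor of line 0 is `det^ℓ` for ONE integer `ℓ`. -/
theorem exists_defLambdaExponent (b : {v : InfinitePlace ↥(maximalRealSubfield L) // v.IsReal}) (hb : b ≠ HypCensus.cmPlace (L : Type) ι₁) :
    ∃ ℓ : ℤ, ∀ u : UnitaryGroup.archLocal (L : Type) 3 (Matrix.diagonal (frameD V)) (cmPlaceOver (L : Type) b),
      ((defLambdaChar V S hGR hGR₀ hGR₁ b u : ℂˣ) : ℂ) =
        (((u : UnitaryGroup.archLocal (L : Type) 3 (Matrix.diagonal (frameD V)) (cmPlaceOver (L : Type) b)) : GL (Fin 3) ℂ) :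
          Matrix (Fin 3) (Fin 3) ℂ).det ^ ℓ := by
  -- read the character on `unitaryGroupOfForm conj (diagonal h)` through the identity of subgroups
  let e := MulEquiv.subgroupCongr (archLocal_eq_form V b)
  let χ : ↥(unitaryGroupOfForm (starRingEnd ℂ) (Matrix.diagonal (placeEntries V b))) →* ℂˣ :=
    (defLambdaChar V S hGR hGR₀ hGR₁ b).comp e.symm.toMonoidHom
  have he : Continuous fun g : ↥(unitaryGroupOfForm (starRingEnd ℂ) (Matrix.diagonal (placeEntries V b))) => e.symm g :=
    Continuous.subtype_mk continuous_subtype_val _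
  have hχ : Continuous fun g => ((χ g : ℂˣ) : ℂ) := (continuous_defLambdaChar V S hGR hGR₀ hGR₁ h₁W b).comp he
  obtain ⟨m, hm⟩ := U3FormChar.exists_zpow_of_continuous_form (placeEntries V b) (placeEntries_real V b) (placeEntries_sign V hb) χ hχ
  refine ⟨m, fun u => ?_⟩
  have h := hm (e u)
  have h1 : e.symm (e u) = u := e.symm_apply_apply u
  simp only [χ, MonoidHom.comp_apply, MulEquiv.coe_toMonoidHom, h1] at h
  exact h

/-- **the exponent OF RECORD `ℓ_b`** of the see-saw factor at the definite place `b` (one `Classical.choose`). -/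
def defLambdaExponent (b : {v : InfinitePlace ↥(maximalRealSubfield L) // v.IsReal}) (hb : b ≠ HypCensus.cmPlace (L : Type) ι₁) : ℤ :=
  (exists_defLambdaExponent V S hGR hGR₀ hGR₁ h₁W b hb).choose

/-- (Ported verbatim from the HodgeCMPerL package; no docstring in the source.) -/
theorem defLambdaChar_eq_zpow (b : {v : InfinitePlace ↥(maximalRealSubfield L) // v.IsReal}) (hb : b ≠ HypCensus.cmPlace (L : Type) ι₁)
    (u : UnitaryGroup.archLocal (L : Type) 3 (Matrix.diagonal (frameD V)) (cmPlaceOver (L : Type) b)) :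
    ((defLambdaChar V S hGR hGR₀ hGR₁ b u : ℂˣ) : ℂ) =
      (((u : UnitaryGroup.archLocal (L : Type) 3 (Matrix.diagonal (frameD V)) (cmPlaceOver (L : Type) b)) : GL (Fin 3) ℂ) :
        Matrix (Fin 3) (Fin 3) ℂ).det ^ defLambdaExponent V S hGR hGR₀ hGR₁ h₁W b hb :=
  (exists_defLambdaExponent V S hGR hGR₀ hGR₁ h₁W b hb).choose_spec u

/-! ## § 4 The (c5)₀ socket -/

/-- **THE (c5)₀ SOCKET.**  If the η₀-part of the line-0 scalar is `det(u)^{m b}` on every `U(V)(L_b)`, `b ≠ v₁`, and the types satisfy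
`m b + ℓ_b + a b = 0`, then the `hdef` hypothesis of #CA27 `harch_zero_of_defTypeG` holds (so `harch₀` follows from the exponent table `hω`). -/
theorem hdef_zero_of_archType (a m : {v : InfinitePlace ↥(maximalRealSubfield L) // v.IsReal} → ℤ)
    (hη : ∀ b : {v : InfinitePlace ↥(maximalRealSubfield L) // v.IsReal}, b ≠ HypCensus.cmPlace (L : Type) ι₁ →
      ∀ u : UnitaryGroup.archLocal (L : Type) 3 (Matrix.diagonal (frameD V)) (cmPlaceOver (L : Type) b),
        ((η₀ (UnitaryGroup.archToAdelic (↥(maximalRealSubfield L)) L (IsCMField.complexConj L) 3 (Matrix.diagonal (frameD V))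
            (UnitaryGroup.archSingle (↥(maximalRealSubfield L)) L (IsCMField.complexConj L) 3 (Matrix.diagonal (frameD V))
              (IsCMField.complexConj_ne_one L) (NumberField.complexConj_smul_infinitePlace (L : Type)) (cmPlaceOver (L : Type) b) u), 1) : ℂˣ) : ℂ) =
          (((u : UnitaryGroup.archLocal (L : Type) 3 (Matrix.diagonal (frameD V)) (cmPlaceOver (L : Type) b)) : GL (Fin 3) ℂ) :
            Matrix (Fin 3) (Fin 3) ℂ).det ^ m b)
    (hm : ∀ b : {v : InfinitePlace ↥(maximalRealSubfield L) // v.IsReal}, ∀ hb : b ≠ HypCensus.cmPlace (L : Type) ι₁,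
      m b + defLambdaExponent V S hGR hGR₀ hGR₁ h₁W b hb + a b = 0) :
    ∀ b : {v : InfinitePlace ↥(maximalRealSubfield L) // v.IsReal}, b ≠ HypCensus.cmPlace (L : Type) ι₁ →
      ∀ u : UnitaryGroup.archLocal (L : Type) 3 (Matrix.diagonal (frameD V)) (cmPlaceOver (L : Type) b),
        ((archScalar_zeroG V S hGR hGR₀ hGR₁ η₀
            (UnitaryGroup.archSingle (↥(maximalRealSubfield L)) L (IsCMField.complexConj L) 3 (Matrix.diagonal (frameD V))
              (IsCMField.complexConj_ne_one L) (NumberField.complexConj_smul_infinitePlace (L : Type)) (cmPlaceOver (L : Type) b) u) : ℂˣ) : ℂ) *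
          (((u : UnitaryGroup.archLocal (L : Type) 3 (Matrix.diagonal (frameD V)) (cmPlaceOver (L : Type) b)) : GL (Fin 3) ℂ) :
              Matrix (Fin 3) (Fin 3) ℂ).det ^ a b = 1 := by
  intro b hb u
  have hdet : (((u : UnitaryGroup.archLocal (L : Type) 3 (Matrix.diagonal (frameD V)) (cmPlaceOver (L : Type) b)) : GL (Fin 3) ℂ) :
      Matrix (Fin 3) (Fin 3) ℂ).det ≠ 0 := by
    rw [← Matrix.GeneralLinearGroup.val_det_apply]
    exact Units.ne_zero _
  rw [archScalar_zeroG_archSingle, Units.val_mul, hη b hb u, defLambdaChar_eq_zpow V S hGR hGR₀ hGR₁ h₁W b hb u,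
    ← zpow_add₀ hdet, ← zpow_add₀ hdet, hm b hb, zpow_zero]

end LambdaDef

end HodgeCM.Model

end
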